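import Mathlib
import Literature.MathematicalPhysics.StatisticalMechanics.LennardJonesClusters
import Summits.AtomisticToContinuum.Crystallization.Theorems.ChessboardParticlePlanesLjLaminarWindowsForceBalance
import HarnessLib

/-!
# Second variation (Earnshaw) inequalities for Lennard-Jones ground states

Helper file of line `Sketch`, crux `LjLaminarWindows` (stmt-AtomisticToContinuum-6711), towards the
cohesion input `stub_noFoam` (≡ stmt-AtomisticToContinuum-13453): the first provable no-void facts.

A ground state `x : Fin N → ℝᵈ` of `V_LJ(r) = r⁻¹²/12 - r⁻⁶/6` is a local minimum of the energy
under the rigid translation `x_p ↦ x_p + t e` (`p ∈ S`) of ANY group `S` of particles, for every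
vector `e`.  The first variation vanishes (force balance, `…ForceBalance.lean`); here we use the
SECOND variation: `t ↦ ∑_{p ∈ S} ∑_{k ∉ S} V_LJ(‖x_p - x_k + t e‖)` has a non-negative second
derivative at `t = 0`.  Summing over an orthonormal basis (`d = 3`) gives the trace (Earnshaw)
inequality

  `∑_{p ∈ S} ∑_{k ∉ S} (ΔV_LJ)(r_{pk}) ≥ 0`,  `ΔV_LJ(r) = V''(r) + 2V'(r)/r = 11 r⁻¹⁴ - 5 r⁻⁸`,

and since `ΔV_LJ(r) < 0` for `r⁶ > 11/5`: **every non-empty proper group of particles of a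
Lennard-Jones ground state in `ℝ³` has a member within distance `(11/5)^{1/6} < 1.1404` of a
particle outside the group** (the `1.1404`-bond graph of a ground state is connected; in
particular every particle of a ground state with `N ≥ 2` has a neighbour within `1.1404`).
All statements `[folklore]` (Earnshaw's theorem for strictly superharmonic attractive tails).
-/

noncomputable section

open scoped BigOperators InnerProductSpace
open Filter Topology
open Literature.MathematicalPhysics.StatisticalMechanics

namespace Summit.AtomisticToContinuum.Crystallization.Theorems.LjLaminarWindowsSketch

/-! ## Calculus -/

/-- **A local minimum has non-negative second derivative**: if `f` has derivative `f' t` at every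
`t` near `a`, `f'` has derivative `f''` at `a`, and `a` is a local minimum of `f`, then `0 ≤ f''`
(if `f'' < 0` the second-derivative test makes `a` also a strict-side local maximum, so `f` is
locally constant and `f'' = 0`). [folklore] -/
theorem earnshaw_deriv2_nonneg_of_isLocalMin {f f' : ℝ → ℝ} {f'' a : ℝ}
    (hmin : IsLocalMin f a) (hf : ∀ᶠ t in 𝓝 a, HasDerivAt f (f' t) t)
    (hf' : HasDerivAt f' f'' a) : 0 ≤ f'' := by
  by_contra hneg
  rw [not_le] at hneg
  have hd : deriv f =ᶠ[𝓝 a] f' := hf.mono fun t ht => ht.deriv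
  have hdd : deriv (deriv f) a = f'' := by
    rw [hd.deriv_eq]
    exact hf'.deriv
  have hcont : ContinuousAt f a := hf.self_of_nhds.continuousAt
  have hda : deriv f a = 0 := hmin.deriv_eq_zero
  have hmax : IsLocalMax f a :=
    isLocalMax_of_deriv_deriv_neg (by rw [hdd]; exact hneg) hda hcont
  have hconst : ∀ᶠ t in 𝓝 a, f t = f a := by
    filter_upwards [hmin, hmax] with t h1 h2 using le_antisymm h2 h1
  have hconst2 : deriv f =ᶠ[𝓝 a] fun _ => (0 : ℝ) := by
    filter_upwards [hconst.eventually_nhds] with t ht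
    rw [Filter.EventuallyEq.deriv_eq (ht : f =ᶠ[𝓝 t] fun _ => f a), deriv_const]
  have h0 : deriv (deriv f) a = 0 := by
    rw [hconst2.deriv_eq, deriv_const]
  rw [hdd] at h0
  exact absurd h0 hneg.ne

/-- `d/dt ‖w + t e‖ = ⟪w + s e, e⟫ / ‖w + s e‖` at `t = s`, wherever `w + s e ≠ 0`. [folklore] -/
theorem earnshaw_hasDerivAt_norm_line {F : Type*} [NormedAddCommGroup F] [InnerProductSpace ℝ F]
    (w e : F) {s : ℝ} (hs : w + s • e ≠ 0) :
    HasDerivAt (fun t : ℝ => ‖w + t • e‖) (⟪w + s • e, e⟫_ℝ / ‖w + s • e‖) s := by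
  have h0 : HasDerivAt (fun u : ℝ => ‖(w + s • e) + u • e‖) (⟪w + s • e, e⟫_ℝ / ‖w + s • e‖)
      (s - s) := by
    rw [sub_self]
    exact forceBalance_hasDerivAt_norm_add_smul e hs
  have h3 := HasDerivAt.comp_sub_const s s h0
  refine h3.congr_of_eventuallyEq (Eventually.of_forall fun t => ?_)
  show ‖w + t • e‖ = ‖(w + s • e) + (t - s) • e‖
  rw [sub_smul, add_add_sub_cancel]

/-- `V_LJ'` is differentiable away from `0`, with `V_LJ''(r) = 13 r⁻¹⁴ - 7 r⁻⁸`. [folklore] -/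
theorem earnshaw_hasDerivAt_dLennardJones {r : ℝ} (hr : r ≠ 0) :
    HasDerivAt (fun y : ℝ => -(1 / 12) * (12 * y⁻¹ ^ 13 - 12 * y⁻¹ ^ 7))
      (13 * r⁻¹ ^ 14 - 7 * r⁻¹ ^ 8) r := by
  have hi : HasDerivAt (fun y : ℝ ↦ y⁻¹) (-(r ^ 2)⁻¹) r := hasDerivAt_inv hr
  have h := (((hi.fun_pow 13).const_mul (12 : ℝ)).fun_sub
    ((hi.fun_pow 7).const_mul (12 : ℝ))).const_mul (-(1 / 12) : ℝ)
  refine h.congr_deriv ?_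
  push_cast
  field_simp
  ring

/-! ## The second variation of one pair term `t ↦ V_LJ(‖w + t e‖)` -/

/-- First derivative of `t ↦ V_LJ(‖w + t e‖)` near `t = 0` (`w ≠ 0`):
`V_LJ'(‖w + t e‖) · ⟪w + t e, e⟫ / ‖w + t e‖`. [folklore] -/
theorem earnshaw_pair_hasDerivAt_eventually {F : Type*} [NormedAddCommGroup F]
    [InnerProductSpace ℝ F] {w : F} (e : F) (hw : w ≠ 0) :
    ∀ᶠ t in 𝓝 (0 : ℝ), HasDerivAt (fun t : ℝ => lennardJones ‖w + t • e‖)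
      (-(1 / 12) * (12 * ‖w + t • e‖⁻¹ ^ 13 - 12 * ‖w + t • e‖⁻¹ ^ 7) *
        (⟪w + t • e, e⟫_ℝ / ‖w + t • e‖)) t := by
  have hcont : Continuous fun t : ℝ => w + t • e := by fun_prop
  have h0 : w + (0 : ℝ) • e ≠ 0 := by rwa [zero_smul, add_zero]
  filter_upwards [hcont.continuousAt.eventually_ne h0] with t ht
  exact (forceBalance_hasDerivAt_lennardJones (norm_ne_zero_iff.2 ht)).comp t
    (earnshaw_hasDerivAt_norm_line w e ht)

/-- Second derivative of `t ↦ V_LJ(‖w + t e‖)` at `t = 0` (`w ≠ 0`, `r = ‖w‖`):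
`(14 r⁻¹⁶ - 8 r⁻¹⁰) ⟪w, e⟫² + (r⁻⁸ - r⁻¹⁴) ⟪e, e⟫`
(`= V''(r) ⟪w,e⟫²/r² + V'(r) (⟪e,e⟫/r - ⟪w,e⟫²/r³)`). [folklore] -/
theorem earnshaw_pair_hasDerivAt_deriv {F : Type*} [NormedAddCommGroup F]
    [InnerProductSpace ℝ F] {w : F} (e : F) (hw : w ≠ 0) :
    HasDerivAt (fun t : ℝ => -(1 / 12) * (12 * ‖w + t • e‖⁻¹ ^ 13 - 12 * ‖w + t • e‖⁻¹ ^ 7) *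
        (⟪w + t • e, e⟫_ℝ / ‖w + t • e‖))
      ((14 * ‖w‖⁻¹ ^ 16 - 8 * ‖w‖⁻¹ ^ 10) * ⟪w, e⟫_ℝ ^ 2 + (‖w‖⁻¹ ^ 8 - ‖w‖⁻¹ ^ 14) * ⟪e, e⟫_ℝ)
      0 := by
  have hr : HasDerivAt (fun t : ℝ => ‖w + t • e‖) (⟪w, e⟫_ℝ / ‖w‖) 0 :=
    forceBalance_hasDerivAt_norm_add_smul e hw
  have hw0 : ‖w‖ ≠ 0 := norm_ne_zero_iff.2 hw
  have hw0' : ‖w + (0 : ℝ) • e‖ ≠ 0 := by rwa [zero_smul, add_zero]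
  -- `t ↦ V'(‖w + t e‖)`
  have hV' : HasDerivAt (fun t : ℝ => -(1 / 12) * (12 * ‖w + t • e‖⁻¹ ^ 13 - 12 * ‖w + t • e‖⁻¹ ^ 7))
      ((13 * ‖w‖⁻¹ ^ 14 - 7 * ‖w‖⁻¹ ^ 8) * (⟪w, e⟫_ℝ / ‖w‖)) 0 := by
    have h2 : HasDerivAt (fun y : ℝ => -(1 / 12) * (12 * y⁻¹ ^ 13 - 12 * y⁻¹ ^ 7))
        (13 * ‖w‖⁻¹ ^ 14 - 7 * ‖w‖⁻¹ ^ 8) ‖w + (0 : ℝ) • e‖ := by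
      rw [zero_smul, add_zero]
      exact earnshaw_hasDerivAt_dLennardJones hw0
    have h3 := h2.comp (0 : ℝ) hr
    exact h3
  -- `t ↦ ⟪w + t e, e⟫`
  have hip : HasDerivAt (fun t : ℝ => ⟪w + t • e, e⟫_ℝ) ⟪e, e⟫_ℝ 0 := by
    have h := ((hasDerivAt_id (0 : ℝ)).mul_const ⟪e, e⟫_ℝ).const_add ⟪w, e⟫_ℝ
    rw [one_mul] at h
    refine h.congr_of_eventuallyEq (Eventually.of_forall fun t => ?_)
    show ⟪w + t • e, e⟫_ℝ = ⟪w, e⟫_ℝ + id t * ⟪e, e⟫_ℝ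
    rw [inner_add_left, real_inner_smul_left, id]
  have hq := hip.div hr hw0'
  have h := hV'.mul hq
  refine h.congr_deriv ?_
  simp only [Pi.div_apply, zero_smul, add_zero]
  field_simp
  ring

/-- **Trace over an orthonormal basis** (`d = 3`): summing the second variation of a pair term
over the three coordinate directions gives the Laplacian of `V_LJ` at `r = ‖w‖`,
`ΔV_LJ(r) = V''(r) + 2V'(r)/r = 11 r⁻¹⁴ - 5 r⁻⁸`. [folklore] -/
theorem earnshaw_trace (w : EuclideanSpace ℝ (Fin 3)) (hw : w ≠ 0) :
    ∑ i : Fin 3, ((14 * ‖w‖⁻¹ ^ 16 - 8 * ‖w‖⁻¹ ^ 10) *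
        ⟪w, EuclideanSpace.single i (1 : ℝ)⟫_ℝ ^ 2 +
      (‖w‖⁻¹ ^ 8 - ‖w‖⁻¹ ^ 14) *
        ⟪EuclideanSpace.single i (1 : ℝ), EuclideanSpace.single i (1 : ℝ)⟫_ℝ)
      = 11 * ‖w‖⁻¹ ^ 14 - 5 * ‖w‖⁻¹ ^ 8 := by
  have h1 : ∀ i : Fin 3, ⟪w, EuclideanSpace.single i (1 : ℝ)⟫_ℝ = w i := fun i => by
    rw [EuclideanSpace.inner_single_right]
    simp
  have h2 : ∀ i : Fin 3,
      ⟪EuclideanSpace.single i (1 : ℝ), EuclideanSpace.single i (1 : ℝ)⟫_ℝ = 1 := fun i => by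
    rw [EuclideanSpace.inner_single_right]
    simp
  have h3 : ∑ i : Fin 3, (w i) ^ 2 = ‖w‖ ^ 2 := (EuclideanSpace.real_norm_sq_eq w).symm
  simp only [h1, h2, mul_one, Finset.sum_add_distrib, ← Finset.mul_sum, h3, Finset.sum_const,
    Finset.card_univ, Fintype.card_fin, nsmul_eq_mul]
  have hw0 : ‖w‖ ≠ 0 := norm_ne_zero_iff.2 hw
  field_simp
  push_cast
  ring

/-! ## Rigid translation of a group of particles in a ground state -/

variable {d N : ℕ}

/-- **Criticality under rigid translation of a group.** In a Lennard-Jones ground state `x`, for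
every set `S` of particles and vector `e`, the cross interaction
`t ↦ ∑_{p ∈ S} ∑_{k ∉ S} V_LJ(‖x_p - x_k + t e‖)` has a local minimum at `t = 0`: for small
`|t|` the translated group still avoids the other particles, the intra-group and extra-group
terms do not change, and the total energy of a ground state cannot decrease. [folklore] -/
theorem earnshaw_isLocalMin_translate {x : Fin N → EuclideanSpace ℝ (Fin d)}
    (hx : IsGroundState lennardJones x) (S : Finset (Fin N)) (e : EuclideanSpace ℝ (Fin d)) :
    IsLocalMin (fun t : ℝ => ∑ p ∈ S, ∑ k ∈ Sᶜ, lennardJones ‖x p - x k + t • e‖) 0 := by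
  -- for `t` near `0`, translated particles avoid the fixed ones
  have hev : ∀ᶠ t in 𝓝 (0 : ℝ), ∀ p k, p ∈ S → k ∉ S → x p + t • e ≠ x k := by
    refine Filter.eventually_all.2 fun p => Filter.eventually_all.2 fun k => ?_
    by_cases hpk : p ∈ S ∧ k ∉ S
    · have hne : p ≠ k := fun h => hpk.2 (h ▸ hpk.1)
      have hcont : Continuous fun t : ℝ => x p + t • e := by fun_prop
      have h0 : x p + (0 : ℝ) • e ≠ x k := by
        rw [zero_smul, add_zero]
        exact hx.1.ne hne
      exact (hcont.continuousAt.eventually_ne h0).mono fun t ht _ _ => ht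
    · exact Eventually.of_forall fun t hp hk => (hpk ⟨hp, hk⟩).elim
  filter_upwards [hev] with t ht
  -- the translated configuration `y`
  set y : Fin N → EuclideanSpace ℝ (Fin d) := fun i => if i ∈ S then x i + t • e else x i with hy
  have hyS : ∀ i ∈ S, y i = x i + t • e := fun i hi => by simp [hy, hi]
  have hyC : ∀ i ∈ Sᶜ, y i = x i := fun i hi => by simp [hy, Finset.mem_compl.1 hi]
  have hinj : Function.Injective y := by
    intro a b hab
    by_cases ha : a ∈ S <;> by_cases hb : b ∈ S
    · rw [hyS a ha, hyS b hb] at hab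
      exact hx.1 (add_right_cancel hab)
    · rw [hyS a ha, hyC b (Finset.mem_compl.2 hb)] at hab
      exact absurd hab (ht a b ha hb)
    · rw [hyC a (Finset.mem_compl.2 ha), hyS b hb] at hab
      exact absurd hab.symm (ht b a hb ha)
    · rw [hyC a (Finset.mem_compl.2 ha), hyC b (Finset.mem_compl.2 hb)] at hab
      exact hx.1 hab
  have hle : interactionEnergy lennardJones x ≤ interactionEnergy lennardJones y := by
    rw [hx.2]
    exact groundStateEnergy_lennardJones_le hinj
  -- double sums, split along `S`
  have hxE := two_mul_interactionEnergy_eq_sum_sum lennardJones lennardJones_zero x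
  have hyE := two_mul_interactionEnergy_eq_sum_sum lennardJones lennardJones_zero y
  rw [sum_sum_eq_add_compl _ S] at hxE hyE
  have hSS : ∑ i ∈ S, ∑ k ∈ S, lennardJones (dist (y i) (y k)) =
      ∑ i ∈ S, ∑ k ∈ S, lennardJones (dist (x i) (x k)) :=
    Finset.sum_congr rfl fun i hi => Finset.sum_congr rfl fun k hk => by
      rw [hyS i hi, hyS k hk, dist_add_right]
  have hCC : ∑ i ∈ Sᶜ, ∑ k ∈ Sᶜ, lennardJones (dist (y i) (y k)) =
      ∑ i ∈ Sᶜ, ∑ k ∈ Sᶜ, lennardJones (dist (x i) (x k)) :=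
    Finset.sum_congr rfl fun i hi => Finset.sum_congr rfl fun k hk => by
      rw [hyC i hi, hyC k hk]
  have hSC : ∑ i ∈ S, ∑ k ∈ Sᶜ, lennardJones (dist (y i) (y k)) =
      ∑ p ∈ S, ∑ k ∈ Sᶜ, lennardJones ‖x p - x k + t • e‖ :=
    Finset.sum_congr rfl fun i hi => Finset.sum_congr rfl fun k hk => by
      rw [hyS i hi, hyC k hk, dist_eq_norm, add_sub_right_comm]
  have hCS : ∑ i ∈ Sᶜ, ∑ k ∈ S, lennardJones (dist (y i) (y k)) =
      ∑ p ∈ S, ∑ k ∈ Sᶜ, lennardJones ‖x p - x k + t • e‖ := by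
    rw [Finset.sum_comm]
    refine Finset.sum_congr rfl fun p hp => Finset.sum_congr rfl fun k hk => ?_
    rw [hyS p hp, hyC k hk, dist_comm, dist_eq_norm, add_sub_right_comm]
  have hSC0 : ∑ i ∈ S, ∑ k ∈ Sᶜ, lennardJones (dist (x i) (x k)) =
      ∑ p ∈ S, ∑ k ∈ Sᶜ, lennardJones ‖x p - x k + (0 : ℝ) • e‖ :=
    Finset.sum_congr rfl fun i _ => Finset.sum_congr rfl fun k _ => by
      rw [zero_smul, add_zero, dist_eq_norm]
  have hCS0 : ∑ i ∈ Sᶜ, ∑ k ∈ S, lennardJones (dist (x i) (x k)) =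
      ∑ p ∈ S, ∑ k ∈ Sᶜ, lennardJones ‖x p - x k + (0 : ℝ) • e‖ := by
    rw [Finset.sum_comm]
    refine Finset.sum_congr rfl fun p _ => Finset.sum_congr rfl fun k _ => ?_
    rw [zero_smul, add_zero, dist_comm, dist_eq_norm]
  rw [hSS, hCC, hSC, hCS] at hyE
  rw [hSC0, hCS0] at hxE
  linarith

/-- **Second variation under rigid translation (any direction).** For a Lennard-Jones ground
state `x`, a set `S` of particles and a vector `e`, with `w = x_p - x_k`, `r = ‖w‖`:
`0 ≤ ∑_{p ∈ S} ∑_{k ∉ S} ((14 r⁻¹⁶ - 8 r⁻¹⁰) ⟪w, e⟫² + (r⁻⁸ - r⁻¹⁴) ⟪e, e⟫)`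
(the second derivative at `t = 0` of the locally minimal cross interaction). [folklore] -/
theorem earnshaw_second_variation_nonneg {x : Fin N → EuclideanSpace ℝ (Fin d)}
    (hx : IsGroundState lennardJones x) (S : Finset (Fin N)) (e : EuclideanSpace ℝ (Fin d)) :
    0 ≤ ∑ p ∈ S, ∑ k ∈ Sᶜ,
      ((14 * ‖x p - x k‖⁻¹ ^ 16 - 8 * ‖x p - x k‖⁻¹ ^ 10) * ⟪x p - x k, e⟫_ℝ ^ 2 +
        (‖x p - x k‖⁻¹ ^ 8 - ‖x p - x k‖⁻¹ ^ 14) * ⟪e, e⟫_ℝ) := by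
  have hw : ∀ p ∈ S, ∀ k ∈ Sᶜ, x p - x k ≠ 0 := fun p hp k hk =>
    sub_ne_zero.2 (hx.1.ne fun h => (Finset.mem_compl.1 hk) (h ▸ hp))
  refine earnshaw_deriv2_nonneg_of_isLocalMin (earnshaw_isLocalMin_translate hx S e)
    (f' := fun t => ∑ p ∈ S, ∑ k ∈ Sᶜ,
      -(1 / 12) * (12 * ‖x p - x k + t • e‖⁻¹ ^ 13 - 12 * ‖x p - x k + t • e‖⁻¹ ^ 7) *
        (⟪x p - x k + t • e, e⟫_ℝ / ‖x p - x k + t • e‖)) ?_ ?_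
  · have hev : ∀ᶠ t in 𝓝 (0 : ℝ), ∀ p k, p ∈ S → k ∈ Sᶜ →
        HasDerivAt (fun t : ℝ => lennardJones ‖x p - x k + t • e‖)
          (-(1 / 12) * (12 * ‖x p - x k + t • e‖⁻¹ ^ 13 - 12 * ‖x p - x k + t • e‖⁻¹ ^ 7) *
            (⟪x p - x k + t • e, e⟫_ℝ / ‖x p - x k + t • e‖)) t := by
      refine Filter.eventually_all.2 fun p => Filter.eventually_all.2 fun k => ?_
      by_cases hpk : p ∈ S ∧ k ∈ Sᶜ
      · exact (earnshaw_pair_hasDerivAt_eventually e (hw p hpk.1 k hpk.2)).mono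
          fun t ht _ _ => ht
      · exact Eventually.of_forall fun t hp hk => (hpk ⟨hp, hk⟩).elim
    filter_upwards [hev] with t ht
    exact HasDerivAt.fun_sum fun p hp => HasDerivAt.fun_sum fun k hk => ht p k hp hk
  · exact HasDerivAt.fun_sum fun p hp => HasDerivAt.fun_sum fun k hk =>
      earnshaw_pair_hasDerivAt_deriv e (hw p hp k hk)

/-! ## The Earnshaw inequality and connectivity in `ℝ³` -/

/-- **Earnshaw inequality for Lennard-Jones ground states** (`d = 3`): for every set `S` of
particles of a ground state `x`,
`0 ≤ ∑_{p ∈ S} ∑_{k ∉ S} ΔV_LJ(‖x_p - x_k‖)`, `ΔV_LJ(r) = 11 r⁻¹⁴ - 5 r⁻⁸`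
(trace of the non-negative second variation of the energy under rigid translations of the
group `S`). [folklore] -/
theorem earnshaw_laplacian_sum_nonneg {x : Fin N → EuclideanSpace ℝ (Fin 3)}
    (hx : IsGroundState lennardJones x) (S : Finset (Fin N)) :
    0 ≤ ∑ p ∈ S, ∑ k ∈ Sᶜ, (11 * ‖x p - x k‖⁻¹ ^ 14 - 5 * ‖x p - x k‖⁻¹ ^ 8) := by
  have hw : ∀ p ∈ S, ∀ k ∈ Sᶜ, x p - x k ≠ 0 := fun p hp k hk =>
    sub_ne_zero.2 (hx.1.ne fun h => (Finset.mem_compl.1 hk) (h ▸ hp))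
  have h := Finset.sum_nonneg fun (i : Fin 3) (_ : i ∈ Finset.univ) =>
    earnshaw_second_variation_nonneg hx S (EuclideanSpace.single i (1 : ℝ))
  rw [Finset.sum_comm] at h
  refine h.trans_eq (Finset.sum_congr rfl fun p hp => ?_)
  rw [Finset.sum_comm]
  exact Finset.sum_congr rfl fun k hk => earnshaw_trace (x p - x k) (hw p hp k hk)

/-- `ΔV_LJ(r) = 11 r⁻¹⁴ - 5 r⁻⁸ < 0` as soon as `r⁶ > 11/5`: the Lennard-Jones potential is
strictly superharmonic beyond `(11/5)^{1/6} ≈ 1.1404`. [folklore] -/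
theorem earnshaw_laplacian_neg {r : ℝ} (hr : 11 / 5 < r ^ 6) :
    11 * r⁻¹ ^ 14 - 5 * r⁻¹ ^ 8 < 0 := by
  have hr0 : r ≠ 0 := by
    rintro rfl
    norm_num at hr
  have hr2 : 0 < r ^ 2 := by positivity
  have e : 11 * r⁻¹ ^ 14 - 5 * r⁻¹ ^ 8 = (r ^ 2)⁻¹ ^ 7 * (11 - 5 * r ^ 6) := by
    field_simp
  rw [e]
  exact mul_neg_of_pos_of_neg (by positivity) (by linarith)

/-- **No detached groups (connectivity at scale `(11/5)^{1/6}`).** In a Lennard-Jones ground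
state in `ℝ³`, every non-empty group `S` of particles with non-empty complement has a member `p`
and a non-member `k` with `‖x_p - x_k‖⁶ ≤ 11/5`, i.e. at distance `≤ (11/5)^{1/6} < 1.141`:
otherwise every cross term of the Earnshaw inequality would be negative.  Equivalently, the graph
on the particles with bonds `‖x_p - x_k‖⁶ ≤ 11/5` is connected. [folklore] -/
theorem earnshaw_exists_cross_pair {x : Fin N → EuclideanSpace ℝ (Fin 3)}
    (hx : IsGroundState lennardJones x) {S : Finset (Fin N)} (hS : S.Nonempty)
    (hSc : Sᶜ.Nonempty) :
    ∃ p ∈ S, ∃ k ∈ Sᶜ, dist (x p) (x k) ^ 6 ≤ 11 / 5 := by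
  by_contra hcon
  push Not at hcon
  have hneg : ∀ p ∈ S, ∑ k ∈ Sᶜ, (11 * ‖x p - x k‖⁻¹ ^ 14 - 5 * ‖x p - x k‖⁻¹ ^ 8) < 0 :=
    fun p hp => Finset.sum_neg (fun k hk => earnshaw_laplacian_neg
      (by simpa only [dist_eq_norm] using hcon p hp k hk)) hSc
  exact absurd (earnshaw_laplacian_sum_nonneg hx S) (not_le.2 (Finset.sum_neg hneg hS))

/-- **Every particle has a near neighbour.** In a Lennard-Jones ground state in `ℝ³` with at
least two particles, every particle `p` has another particle `k` with `‖x_p - x_k‖⁶ ≤ 11/5`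
(the case `S = {p}` of `earnshaw_exists_cross_pair`; Earnshaw: a particle all of whose
neighbours sit in the strictly superharmonic tail `r > (11/5)^{1/6}` of `V_LJ` is not at a local
minimum of the energy). [folklore] -/
theorem earnshaw_exists_near_neighbour {x : Fin N → EuclideanSpace ℝ (Fin 3)}
    (hx : IsGroundState lennardJones x) (p q : Fin N) (hpq : p ≠ q) :
    ∃ k, k ≠ p ∧ dist (x p) (x k) ^ 6 ≤ 11 / 5 := by
  obtain ⟨p', hp', k, hk, h⟩ := earnshaw_exists_cross_pair hx (S := {p})
    (Finset.singleton_nonempty p) ⟨q, by simpa using hpq.symm⟩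
  rw [Finset.mem_singleton] at hp'
  subst hp'
  exact ⟨k, by simpa using hk, h⟩

/-- Numerical form: `r⁶ ≤ 11/5` forces `r < 1.141` (`1.141⁶ > 2.2`), so in a Lennard-Jones
ground state in `ℝ³` with `N ≥ 2` every particle has a neighbour at distance `< 1.141`, and every
group of particles with non-empty complement is within `1.141` of its complement. [folklore] -/
theorem earnshaw_dist_lt_of_pow_six_le {r : ℝ} (h : r ^ 6 ≤ 11 / 5) :
    r < 1141 / 1000 := by
  by_contra hle
  rw [not_lt] at hle
  have h6 : (1141 / 1000 : ℝ) ^ 6 ≤ r ^ 6 := pow_le_pow_left₀ (by norm_num) hle 6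
  norm_num at h6
  linarith

/-- **Registered form (sub-goal `stub_earnshawConnectivity` of crux stmt-AtomisticToContinuum-6711,
towards the cohesion input `stub_noFoam`).** Every Lennard-Jones ground state in `ℝ³` is
`(11/5)^{1/6}`-connected: a non-empty group of particles with non-empty complement has a member
and a non-member with `dist⁶ ≤ 11/5`. [folklore] -/
theorem stub_earnshawConnectivity :
    ∀ (N : ℕ) (x : Fin N → EuclideanSpace ℝ (Fin 3)), IsGroundState lennardJones x →
      ∀ S : Finset (Fin N), S.Nonempty → Sᶜ.Nonempty →
        ∃ p ∈ S, ∃ k ∈ Sᶜ, dist (x p) (x k) ^ 6 ≤ 11 / 5 :=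
  fun _ _ hx _ hS hSc => earnshaw_exists_cross_pair hx hS hSc

end Summit.AtomisticToContinuum.Crystallization.Theorems.LjLaminarWindowsSketch

end
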